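import Summits.CriticalPhenomena.PercolationContinuityZ3.Theorems.PercNearOneGluingNoHeavyQuantFarSunWeakestBet
import Summits.CriticalPhenomena.PercolationContinuityZ3.Theorems.PercNearOneGluingNoHeavyQuantSurplusFARCantelli
import Summits.CriticalPhenomena.PercolationContinuityZ3.Theorems.PercNearOneGluingNoHeavyQuantDeficitFARAllLayers
import HarnessLib

/-!
# FAR beyond trees: THM B AT EVERY LAYER — the WEAKEST-HAIR BET `W(μ_W)` is a hair-only certificate for `SunFAR K j` (`j ≥ 2`)
# whenever `η(Σ − 2j) ≤ j(F − η)`  (LEMMA L at every layer: its long rows never bind)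

builds on p205010 (kernel theorem, internal audit signed; external expert review pending)

Support file (`--supports stmt-CriticalPhenomena-4575`), seat `prim-cert-1` (gen 41); memo `prim-cert-1/FROM-prim-cert-1-g41-ALL-LAYERS.md` §1
(the layer-`2` file is `…QuantFarSunWeakestBet`, gen 37, with memos g34 §3 / g37 §1, §4).  Layer `j ≥ 2` throughout.
Notation: hair weights `h k ∈ [0,1]`, `Σ = Σ_{k<K} h k`, `η = h m` a least weight, `F = hairV K h j (range K) = P(T ≥ j+1)`, for a position set `C`:
`E(C) = Σ_{k∈C} h k`, `V(C) = hairV K h j C = P(N_C ≥ j+1)`.  The weakest-hair bet is the certificate `λ = δ_m`, `μ_W = (F − η)/(Σ − 2j)`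
(rows `η·𝟙[m ∈ C] + μ_W (E(C) − 2j) ≤ V(C)` on the coverage sets; the full row is tight by construction).

THE POINT OF THIS FILE (memo §1): the two one-Poisson-binomial inputs of THM B hold at EVERY layer with two-line proofs —
* the deficit inequality `η(E(C) − j)/j ≤ V(C)` for `E(C) ≤ 2j` is `Quant.CountDP.deficit_far` (Markov/Cantelli, `…QuantDeficitFARAllLayers`);
* the surplus inequality `(1 − V(C))(E(C) − 2j + 1) ≤ 1 − η` for `E(C) ≥ 2j` is needed ONLY when `η·E(C) ≤ j²`, where it is one Cantelli step
  (`Quant.CountDP.surplus_far_cantelli`, `…QuantSurplusFARCantelli`): indeed THM B's hypothesis `η(Σ − 2j) ≤ j(F − η) ≤ j(1 − η)` gives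
  `ηΣ ≤ j(1 + η) ≤ 2j ≤ j²`, and `E(C) ≤ Σ`.  (At `j = 2` gen 37 proved the surplus inequality without the side condition, via Chernoff + AM–GM + a table;
  that generality is not needed.)

* `HairyCycle.one_sub_hairV_mul_le_of_sq` — surplus on a position set (`E(C) ≥ 2j`, `η E(C) ≤ j²`); `HairyCycle.eta_le_hairV_univ_of_sq` — `η ≤ F`.
* `HairyCycle.deficit_le_hairV_all` — deficit on a position set (`E(C) ≤ 2j`, `η > 0`).
* **`HairyCycle.lemmaL_all`** — LEMMA L at layer `j`: for `ηΣ ≤ j²` and every `C ⊆ range K` with `E(C) > 2j`:  `(F − η)(E(C) − 2j) ≤ (V(C) − η)(Σ − 2j)`.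
* **`HairyCycle.hairCert_of_weakestBet_all`** — THM B at layer `j ≥ 2`: if `2j < Σ`, `η = h m` is a least weight and `η(Σ − 2j) ≤ j(F − η)`, then
  `(δ_m, μ_W)` is a hair-only certificate in the hypothesis shape of `HairyCycle.sunFAR_of_hairCert`.
With the universal-witness rule (`HairyCycle.sunFAR_of_hairCert_lowWitAvg`, valid when `G_avg ≥ 1`) this leaves, for `SunFAR K j` at every `K` and
every layer `j ≥ 2`, exactly the inequality `G_avg ≥ 1` on `R_j = {η(Σ − 2j) > j(F − η)}` (`…QuantFarSunAllLayersK`).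
No definitions, no sorries, standard axioms.  Elementary [this work].
-/

noncomputable section

namespace Summit.CriticalPhenomena.PercolationContinuityZ3.Theorems.HairyCycle

open Finset
open scoped Classical

/-- `PB[p, m] b` = probability that exactly `b` of the first `m` independent trials succeed (the recursion of `…QuantCountDP.lean`). -/
local notation3 "PB[" p ", " m "]" =>
  (Nat.rec (motive := fun _ => ℕ → ℝ) (fun b => if b = 0 then (1 : ℝ) else 0)
    (fun n f b => (p : ℕ → ℝ) n * (if b = 0 then (0 : ℝ) else f (b - 1)) + (1 - (p : ℕ → ℝ) n) * f b) (m : ℕ))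

variable {K : ℕ}

/-! ## The two one-Poisson-binomial inequalities on a position set, every layer -/

/-- **Surplus on a position set, layer `j ≥ 1`, Cantelli regime**: for `C ⊆ range K` with `E(C) ≥ 2j`, `η·E(C) ≤ j²` and `η ≤ h k`
(`k < K`):  `(1 − V(C))·(E(C) − 2j + 1) ≤ 1 − η` (`Quant.CountDP.surplus_far_cantelli` through the bridge `hairV_eq_one_sub_cdf`). [this work] -/
theorem one_sub_hairV_mul_le_of_sq {h : ℕ → ℝ} (hh : ∀ k, 0 ≤ h k ∧ h k ≤ 1) {η : ℝ} (hη : ∀ k, k < K → η ≤ h k)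
    {j : ℕ} (hj : 1 ≤ j) {C : Finset ℕ} (hC : C ⊆ range K) (hE : (2 * j : ℝ) ≤ ∑ k ∈ C, h k)
    (hA : η * ∑ k ∈ C, h k ≤ (j : ℝ) ^ 2) :
    (1 - hairV K h j C) * (∑ k ∈ C, h k - 2 * j + 1) ≤ 1 - η := by
  have hb := hairV_eq_one_sub_cdf (K := K) h j C
  have hs := Quant.CountDP.surplus_far_cantelli (fun i => h (Nat.nth (· ∈ C) i)) (nth_trials_mem hh C)
    (m := Nat.count (· ∈ C) K) (eta_le_nth_trials hη C) hj (by rw [sum_nth_trials_eq hC h]; exact hE)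
    (by rw [sum_nth_trials_eq hC h]; exact hA)
  rw [sum_nth_trials_eq hC h] at hs
  rw [hb]
  simpa using hs

/-- **`η ≤ F`** at layer `j ≥ 1`: for `Σ ≥ 2j` and `ηΣ ≤ j²`, `η ≤ hairV K h j (range K)`. [this work] -/
theorem eta_le_hairV_univ_of_sq {h : ℕ → ℝ} (hh : ∀ k, 0 ≤ h k ∧ h k ≤ 1) {η : ℝ} (hη : ∀ k, k < K → η ≤ h k)
    {j : ℕ} (hj : 1 ≤ j) (hS : (2 * j : ℝ) ≤ ∑ k ∈ range K, h k) (hA : η * ∑ k ∈ range K, h k ≤ (j : ℝ) ^ 2) :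
    η ≤ hairV K h j (range K) := by
  have h1 := one_sub_hairV_mul_le_of_sq hh hη hj (subset_refl _) hS hA
  have hV1 : hairV K h j (range K) ≤ 1 := hairV_le_one' (fun k _ => hh k) j (range K)
  nlinarith

/-- **Deficit on a position set, layer `j ≥ 2`**: for `C ⊆ range K` with `E(C) ≤ 2j`, `0 < η ≤ h k` (`k < K`):  `η(E(C) − j)/j ≤ V(C)`
(`Quant.CountDP.deficit_far` through the bridge). [this work] -/
theorem deficit_le_hairV_all {h : ℕ → ℝ} (hh : ∀ k, 0 ≤ h k ∧ h k ≤ 1) {η : ℝ} (hη0 : 0 < η) (hη : ∀ k, k < K → η ≤ h k)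
    {j : ℕ} (hj : 2 ≤ j) {C : Finset ℕ} (hC : C ⊆ range K) (hE : ∑ k ∈ C, h k ≤ 2 * j) :
    η * (∑ k ∈ C, h k - j) / j ≤ hairV K h j C := by
  have hb := hairV_eq_one_sub_cdf (K := K) h j C
  have hd := Quant.CountDP.deficit_far (fun i => h (Nat.nth (· ∈ C) i)) (nth_trials_mem hh C) hη0
    (m := Nat.count (· ∈ C) K) (eta_le_nth_trials hη C) hj (by rw [sum_nth_trials_eq hC h]; exact hE)
  rw [sum_nth_trials_eq hC h] at hd
  rw [hb]
  simpa using hd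

/-! ## LEMMA L at every layer -/

/-- **LEMMA L at layer `j ≥ 1` (the long rows of the weakest-hair bet never bind).**  For `h ∈ [0,1]`, any real `η` with `η ≤ h k` (`k < K`)
and `η·Σ ≤ j²`, and every `C ⊆ range K` with `E(C) > 2j`:  `(F − η)·(E(C) − 2j) ≤ (V(C) − η)·(Σ − 2j)`, i.e. the row
`η + μ_W(E(C) − 2j) ≤ V(C)` of `W(μ_W)`.  Proof as at layer two: with `u = E(C) − 2j`, `g = E(gap)`, `δ = F − V(C) ≤ (1 − V(C))·min(1, g)`
(`hairV_univ_sub_hairV_le`) and `(1 − V(C))u ≤ V(C) − η` (surplus): `(F−η)u ≤ (V−η)u + (V−η)min(1,g) ≤ (V−η)(u+g)`. [this work] -/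
theorem lemmaL_all {h : ℕ → ℝ} (hh : ∀ k, 0 ≤ h k ∧ h k ≤ 1) {η : ℝ} (hη : ∀ k, k < K → η ≤ h k)
    {j : ℕ} (hj : 1 ≤ j) (hA : η * ∑ k ∈ range K, h k ≤ (j : ℝ) ^ 2)
    {C : Finset ℕ} (hC : C ⊆ range K) (hE : (2 * j : ℝ) < ∑ k ∈ C, h k) :
    (hairV K h j (range K) - η) * (∑ k ∈ C, h k - 2 * j) ≤ (hairV K h j C - η) * (∑ k ∈ range K, h k - 2 * j) := by
  set V := hairV K h j C with hVdef
  set F := hairV K h j (range K) with hFdef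
  set u := ∑ k ∈ C, h k - 2 * j with hudef
  set g := ∑ k ∈ range K \ C, h k with hgdef
  have hu0 : 0 < u := by rw [hudef]; linarith
  have hg0 : 0 ≤ g := Finset.sum_nonneg fun k _ => (hh k).1
  have hStot : ∑ k ∈ range K, h k - 2 * j = u + g := by
    rw [hudef, hgdef, ← Finset.sum_sdiff hC]; ring
  rw [hStot]
  -- `η E(C) ≤ η Σ ≤ j²` (if `η < 0` the first product is even smaller)
  have hEC_le : ∑ k ∈ C, h k ≤ ∑ k ∈ range K, h k := Finset.sum_le_sum_of_subset_of_nonneg hC fun k _ _ => (hh k).1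
  have hAC : η * ∑ k ∈ C, h k ≤ (j : ℝ) ^ 2 := by
    rcases le_or_gt 0 η with hη0 | hη0
    · exact le_trans (mul_le_mul_of_nonneg_left hEC_le hη0) hA
    · have hEC0 : 0 ≤ ∑ k ∈ C, h k := Finset.sum_nonneg fun k _ => (hh k).1
      have : η * ∑ k ∈ C, h k ≤ 0 := mul_nonpos_of_nonpos_of_nonneg hη0.le hEC0
      have : (0 : ℝ) ≤ (j : ℝ) ^ 2 := by positivity
      linarith
  -- gap bound and surplus
  have hδ : F - V ≤ (1 - V) * min 1 g := hairV_univ_sub_hairV_le (fun k _ => hh k) j C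
  have hs : (1 - V) * (∑ k ∈ C, h k - 2 * j + 1) ≤ 1 - η := one_sub_hairV_mul_le_of_sq hh hη hj hC (by linarith) hAC
  have hs' : (1 - V) * u ≤ V - η := by
    have e : (1 - V) * (∑ k ∈ C, h k - 2 * j + 1) = (1 - V) * u + (1 - V) := by rw [hudef]; ring
    linarith [e ▸ hs]
  have hV1 : V ≤ 1 := hairV_le_one' (fun k _ => hh k) j C
  have hVη : 0 ≤ V - η := le_trans (mul_nonneg (by linarith) hu0.le) hs'
  have hmin0 : 0 ≤ min 1 g := le_min zero_le_one hg0
  have h1 : (F - V) * u ≤ (1 - V) * u * min 1 g := by nlinarith [mul_le_mul_of_nonneg_right hδ hu0.le]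
  have h2 : (1 - V) * u * min 1 g ≤ (V - η) * min 1 g := mul_le_mul_of_nonneg_right hs' hmin0
  have h3 : (V - η) * min 1 g ≤ (V - η) * g := mul_le_mul_of_nonneg_left (min_le_right 1 g) hVη
  nlinarith

/-! ## THM B at every layer -/

/-- **THM B at layer `j ≥ 2` (the weakest-hair bet in its regime).**  Let `h ∈ [0,1]` with `Σ = Σ_{k<K} h k > 2j`, let `m < K` carry a least
weight `η = h m` (`η ≤ h k` for `k < K`), `F = hairV K h j (range K)`, and suppose `η(Σ − 2j) ≤ j(F − η)`.  Then the weakest-hair bet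
`λ = δ_m`, `μ_W = (F − η)/(Σ − 2j)` is a hair-only certificate at layer `j`: `λ ≥ 0`, `Σ_{k<K} λ_k = 1`, `μ_W ≥ 0`, and on every coverage set
`C = cov K l l'`, `(l,l') ∈ arcIx K`:  `Σ_{k∈C} λ_k h_k + μ_W (Σ_{k∈C} h_k − 2j) ≤ hairV K h j C` (the hypothesis shape of
`HairyCycle.sunFAR_of_hairCert`).  Long rows: LEMMA L (the side condition `ηΣ ≤ j²` follows from the hypothesis); short rows through `m`:
the deficit inequality and `μ_W ≥ η/j`; the rest trivially. [this work] -/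
theorem hairCert_of_weakestBet_all {h : ℕ → ℝ} (hh : ∀ k, 0 ≤ h k ∧ h k ≤ 1) {j : ℕ} (hj : 2 ≤ j)
    (hStot : (2 * j : ℝ) < ∑ k ∈ range K, h k)
    {m : ℕ} (hm : m < K) (hmin : ∀ k, k < K → h m ≤ h k)
    (hB : h m * (∑ k ∈ range K, h k - 2 * j) ≤ j * (hairV K h j (range K) - h m)) :
    ∃ lam : ℕ → ℝ, ∃ μ : ℝ, (∀ k, 0 ≤ lam k) ∧ ∑ k ∈ range K, lam k = 1 ∧ 0 ≤ μ ∧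
      ∀ p ∈ arcIx K, ∑ k ∈ cov K p.1 p.2, lam k * h k + μ * (∑ k ∈ cov K p.1 p.2, h k - 2 * j) ≤
        hairV K h j (cov K p.1 p.2) := by
  set η := h m with hηdef
  set S := ∑ k ∈ range K, h k with hSdef
  set F := hairV K h j (range K) with hFdef
  have hj1 : 1 ≤ j := le_trans (by norm_num) hj
  have hj0 : (0 : ℝ) < j := by exact_mod_cast (show 0 < j by omega)
  have hj2 : (2 : ℝ) ≤ j := by exact_mod_cast hj
  have hη0 : 0 ≤ η := (hh m).1
  have hη1 : η ≤ 1 := (hh m).2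
  have hS2j : 0 < S - 2 * j := by linarith
  have hF1 : F ≤ 1 := hairV_le_one' (fun k _ => hh k) j (range K)
  -- the side condition of LEMMA L: `ηΣ ≤ j(1+η) ≤ 2j ≤ j²`
  have hA : η * S ≤ (j : ℝ) ^ 2 := by
    have h1 : η * S ≤ j + j * η := by nlinarith
    nlinarith
  have hFη : η ≤ F := eta_le_hairV_univ_of_sq hh hmin hj1 hStot.le hA
  set μ := (F - η) / (S - 2 * j) with hμdef
  have hμ0 : 0 ≤ μ := div_nonneg (by linarith) hS2j.le
  have hμη : η / j ≤ μ := by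
    rw [hμdef, div_le_div_iff₀ hj0 hS2j]; linarith
  refine ⟨fun k => if k = m then 1 else 0, μ, fun k => by dsimp only; split_ifs <;> norm_num, ?_, hμ0, ?_⟩
  · rw [Finset.sum_ite_eq' (range K) m (fun _ => (1 : ℝ)), if_pos (Finset.mem_range.2 hm)]
  · intro p _
    set C := cov K p.1 p.2 with hCdef
    have hC : C ⊆ range K := fun _ hk => Finset.mem_range.2 (mem_cov.1 hk).1
    set EC := ∑ k ∈ C, h k with hECdef
    set V := hairV K h j C with hVdef
    have hV0 : 0 ≤ V := hairV_nonneg' (fun k _ => hh k) j C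
    -- the bet's row sum on `C`
    have hrow : ∑ k ∈ C, (if k = m then (1 : ℝ) else 0) * h k = if m ∈ C then η else 0 := by
      have e : ∀ k ∈ C, (if k = m then (1 : ℝ) else 0) * h k = if k = m then η else 0 := by
        intro k _
        split_ifs with hk
        · rw [hk, hηdef]; ring
        · ring
      rw [Finset.sum_congr rfl e, Finset.sum_ite_eq' C m (fun _ => η)]
    rw [hrow]
    rcases lt_or_ge (2 * j : ℝ) EC with hlong | hshort
    · ----------------------------------------------------------------
      -- long row: LEMMA L gives `μ (E(C) − 2j) ≤ V − η`
      ----------------------------------------------------------------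
      have hL := lemmaL_all hh hmin hj1 hA hC hlong
      rw [← hECdef, ← hSdef, ← hFdef, ← hVdef] at hL
      have hμE : μ * (EC - 2 * j) ≤ V - η := by
        rw [hμdef, div_mul_eq_mul_div, div_le_iff₀ hS2j]
        linarith
      have hind : (if m ∈ C then η else 0) ≤ η := by split_ifs <;> linarith
      linarith
    · ----------------------------------------------------------------
      -- short row: trivial off `m`; through `m` by the deficit inequality and `μ ≥ η/j`
      ----------------------------------------------------------------
      have hμE : μ * (EC - 2 * j) ≤ 0 := mul_nonpos_of_nonneg_of_nonpos hμ0 (by linarith)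
      by_cases hmC : m ∈ C
      · rw [if_pos hmC]
        rcases eq_or_lt_of_le hη0 with hz | hpos
        · -- `η = 0`
          rw [← hz]; linarith
        · have hd := deficit_le_hairV_all hh hpos hmin hj hC hshort
          rw [← hECdef, ← hVdef] at hd
          -- `η + μ(EC − 2j) ≤ η − (η/j)(2j − EC) = η(EC − j)/j ≤ V`
          have h2j : 0 ≤ 2 * j - EC := by linarith
          have h1 : μ * (EC - 2 * j) ≤ (η / j) * (EC - 2 * j) := by nlinarith [mul_le_mul_of_nonneg_right hμη h2j]
          have h2 : η + (η / j) * (EC - 2 * j) = η * (EC - j) / j := by field_simp; ring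
          linarith
      · rw [if_neg hmC]; linarith

end Summit.CriticalPhenomena.PercolationContinuityZ3.Theorems.HairyCycle

end
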